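/- WIDTH seat `ym-line-cbag-p1-w2` (prover-ym-line-cbag-p1-w2-g22-0; own items stmt-QuantumFields-22254 / 22893 CLOSED·proved), LINE 7
`GlueballBandRecursion`, in support of ⟨stmt-QuantumFields-22957⟩ `OneParticleBlochSymbolFamily` (= `Band.EffectiveBlochSymbolFamily`):
the glue door «QUASI-BAND ⇒ ISOLATED BAND» (flagged by the width seat w4 g9, 2026-08-28T19:08Z, items (D-a)/(D-b)) between what a
cluster expansion delivers — approximately invariant dressed excitations, i.e. a QUASI-band with Rayleigh bounds — and what the
spectral files of the line consume — an EXACT isolated eigen-band (`…BandUpperGap` §2) with a translation-invariant band space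
(`…BlochTransfer`, w3's Löwdin frame).  Part 1/2: the abstract Hilbert-space theory.  Route-independent; definition-free; a helper. -/
import Summits.QuantumFields.YangMills.Theorems.GlueballBandRecursionBandUpperGap

/-!
# Route `GlueballBandRecursion`, item `OneParticleBlochSymbolFamily` (stmt-QuantumFields-22957): quasi-band isolation, abstract part

Setting: a real inner-product space `E`, a symmetric bounded operator `T`, and a subspace `V` (the QUASI-BAND: in the application the
span of the expansion's dressed one-plaquette excitations) with an orthogonal projection `P_V` and three numbers: a Rayleigh FLOOR
`a` on `V` (`a‖v‖² ≤ ⟪v, T v⟫`), a Rayleigh CEILING `θ` on `Vᗮ` (`⟪w, T w⟫ ≤ θ‖w‖²`) and a COUPLING `ε ≥ 0`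
(`|⟪w, T v⟫| ≤ ε‖v‖‖w‖`, `v ∈ V`, `w ∈ Vᗮ`).  No exact eigenvector is assumed anywhere.

* `quasiBand_eigen_ineq`, `eigenvalue_le_or_le_of_quasiBand` (any `V` with an orthogonal projection): an eigenvector `T x = l x`
  splits as `v + w` with `(a − l)‖v‖² ≤ ε‖v‖‖w‖`, `(l − θ)‖w‖² ≤ ε‖v‖‖w‖`; hence EVERY eigenvalue satisfies `l ≤ θ + ε` or
  `l ≥ a − ε` — the window `(θ + ε, a − ε)` carries no eigenvalue.
* With a Hilbert eigenbasis `T bᵢ = λᵢ bᵢ` (the tree's format for the transfer matrix, `exists_eigenData_rate`) and `V`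
  FINITE-DIMENSIONAL with the gap `θ + 2ε < a`: `hasSum_eigenvalue_mul_inner_sq` (`⟪x, T x⟫ = Σᵢ λᵢ⟪bᵢ, x⟫²`), the Rayleigh
  ceiling/floor off/on a set of indices (`inner_le_of_inner_eq_zero`, `le_inner_of_inner_eq_zero`), the finite-support expansion
  (`eq_sum_inner_smul_of_inner_eq_zero`, `mem_span_finset_iff_inner_eq_zero`); `eigenvalue_basis_le_or_le`;
  `eq_zero_of_mem_quasiBand_of_inner_window_eq_zero` (`V` injects into the window by coefficients) and
  `eq_zero_of_mem_orthogonal_of_inner_eq_zero` (the window injects into `V` under `P_V`); and the count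
  **`exists_finset_window_card_eq_finrank`**: `{i : λᵢ ≥ a − ε}` is a FINITE set with exactly `dim V` elements.
* Structure of the window space `W = span {bᵢ : i ∈ s}` for a separated finite index set `s`: `map_mem_span_window_of_commute`
  (every linear `L` commuting with `T` maps `W` into itself), `starProjection_map_eq_map_starProjection` (a linear isometry mapping a
  finite-dimensional `W` into itself commutes with `P_W`), `linearIndependent_starProjection_comp`, `span_eq_of_linearIndependent_of_card_eq`
  — what turns a translation-covariant linearly independent quasi-band frame `φ` into the covariant linearly independent frame
  `P_W φ` spanning `W` that the Löwdin orthonormalisation (w3, `…CovariantFrame`) consumes.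

Part 2 (`…QuasiBandIsolationTransfer.lean`) specialises to `wilsonTorusTransferMatrix` (simple top, quasi-band orthogonal to the ground
state, Koopman translations) and outputs the data of `…BandUpperGap` §2 verbatim.

Sources: folklore two-block (Feshbach/Schur) estimates; Temple, Proc. R. Soc. A 119 (1928) 276; Kato, J. Phys. Soc. Japan 4 (1949) 334;
Davis–Kahan, SIAM J. Numer. Anal. 7 (1970) 1; Reed–Simon IV §XIII.1.  NOT here: any cluster expansion (stub S1), the transfer matrix (part 2).

HONEST FRAMING.  Linear algebra for a conditional door.  Item ⟨stmt-QuantumFields-22957⟩, LINE 7's rung `ColdDoublingRecursionStrongCoupling`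
(RECORD-type, strong coupling) and a fortiori the Yang–Mills mass gap / the summit `YangMills` are NOT proved or advanced here.
-/

set_option autoImplicit false

noncomputable section

open scoped InnerProductSpace BigOperators
open MeasureTheory Filter Topology
open Literature.MathematicalPhysics.QuantumFieldTheory
open Literature.MathematicalPhysics.QuantumFieldTheory.Balaban1983to89.Missing (strongCouplingRadius)

namespace Summit.QuantumFields.YangMills.Theorems.GlueballBandRecursion.Band

/-! ### §1 Abstract: a quasi-band with a Rayleigh gap is an isolated spectral window -/

section Abstract

variable {E : Type*} [NormedAddCommGroup E] [InnerProductSpace ℝ E]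

/-- **The two block inequalities of an eigenvector against a quasi-band.**  `T` symmetric, `V` a subspace with orthogonal
projection `P`, Rayleigh floor `a` on `V`, Rayleigh ceiling `θ` on `Vᗮ`, coupling `|⟪w, T v⟫| ≤ ε‖v‖‖w‖` (`v ∈ V`, `w ∈ Vᗮ`).
For `T x = l x`, with `v = P x`, `w = x − P x`: `(a − l)‖v‖² ≤ ε‖v‖‖w‖` and `(l − θ)‖w‖² ≤ ε‖v‖‖w‖`
(test `T x = l x` against `v` and against `w`). [folklore; Davis–Kahan / Feshbach block estimates] -/
theorem quasiBand_eigen_ineq (T : E →L[ℝ] E) (hT : (T : E →ₗ[ℝ] E).IsSymmetric)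
    (V : Submodule ℝ E) [V.HasOrthogonalProjection] {a θ ε : ℝ}
    (hV : ∀ v ∈ V, a * ‖v‖ ^ 2 ≤ ⟪v, T v⟫_ℝ)
    (hVp : ∀ w ∈ Vᗮ, ⟪w, T w⟫_ℝ ≤ θ * ‖w‖ ^ 2)
    (hcross : ∀ v ∈ V, ∀ w ∈ Vᗮ, |⟪w, T v⟫_ℝ| ≤ ε * ‖v‖ * ‖w‖)
    {x : E} {l : ℝ} (hTx : T x = l • x) :
    (a - l) * ‖V.starProjection x‖ ^ 2 ≤ ε * ‖V.starProjection x‖ * ‖x - V.starProjection x‖ ∧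
      (l - θ) * ‖x - V.starProjection x‖ ^ 2 ≤ ε * ‖V.starProjection x‖ * ‖x - V.starProjection x‖ := by
  set v : E := V.starProjection x with hvdef
  set w : E := x - v with hwdef
  have hv : v ∈ V := V.starProjection_apply_mem x
  have hw : w ∈ Vᗮ := V.sub_starProjection_mem_orthogonal x
  have hvw : ⟪v, w⟫_ℝ = 0 := V.inner_right_of_mem_orthogonal hv hw
  have hx : x = v + w := by rw [hwdef, add_sub_cancel]
  have hTsplit : T x = T v + T w := by rw [hx, map_add]
  -- `⟪v, T w⟫ = ⟪w, T v⟫`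
  have hsym : ⟪v, T w⟫_ℝ = ⟪w, T v⟫_ℝ := by
    rw [← ContinuousLinearMap.coe_coe, ← hT v w, ContinuousLinearMap.coe_coe, real_inner_comm]
  -- testing against `v`
  have h1 : l * ‖v‖ ^ 2 = ⟪v, T v⟫_ℝ + ⟪w, T v⟫_ℝ := by
    have : ⟪v, T x⟫_ℝ = l * ‖v‖ ^ 2 := by
      rw [hTx, real_inner_smul_right, hx, inner_add_right, hvw, add_zero, real_inner_self_eq_norm_sq]
    rw [← this, hTsplit, inner_add_right, hsym]
  -- testing against `w`
  have h2 : l * ‖w‖ ^ 2 = ⟪w, T v⟫_ℝ + ⟪w, T w⟫_ℝ := by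
    have : ⟪w, T x⟫_ℝ = l * ‖w‖ ^ 2 := by
      rw [hTx, real_inner_smul_right, hx, inner_add_right, real_inner_comm, hvw, zero_add,
        real_inner_self_eq_norm_sq]
    rw [← this, hTsplit, inner_add_right]
  have hc := hcross v hv w hw
  have hcl : -(ε * ‖v‖ * ‖w‖) ≤ ⟪w, T v⟫_ℝ := (abs_le.1 hc).1
  have hcu : ⟪w, T v⟫_ℝ ≤ ε * ‖v‖ * ‖w‖ := (abs_le.1 hc).2
  have hVv := hV v hv
  have hVw := hVp w hw
  constructor
  · nlinarith [hVv, hcl, h1]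
  · nlinarith [hVw, hcu, h2]

/-- **Eigenvalue exclusion (quasi-band ⇒ spectral window).**  Under the hypotheses of `quasiBand_eigen_ineq` with `ε ≥ 0`, every
eigenvalue `l` of `T` satisfies `l ≤ θ + ε` or `a − ε ≤ l`: the open window `(θ + ε, a − ε)` is free of spectrum
(if `θ + ε < l < a − ε` the two block inequalities give `‖v‖ < ‖w‖ < ‖v‖`). [folklore] -/
theorem eigenvalue_le_or_le_of_quasiBand (T : E →L[ℝ] E) (hT : (T : E →ₗ[ℝ] E).IsSymmetric)
    (V : Submodule ℝ E) [V.HasOrthogonalProjection] {a θ ε : ℝ} (hε : 0 ≤ ε)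
    (hV : ∀ v ∈ V, a * ‖v‖ ^ 2 ≤ ⟪v, T v⟫_ℝ)
    (hVp : ∀ w ∈ Vᗮ, ⟪w, T w⟫_ℝ ≤ θ * ‖w‖ ^ 2)
    (hcross : ∀ v ∈ V, ∀ w ∈ Vᗮ, |⟪w, T v⟫_ℝ| ≤ ε * ‖v‖ * ‖w‖)
    {x : E} {l : ℝ} (hx : x ≠ 0) (hTx : T x = l • x) :
    l ≤ θ + ε ∨ a - ε ≤ l := by
  obtain ⟨h1, h2⟩ := quasiBand_eigen_ineq T hT V hV hVp hcross hTx
  by_contra h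
  rw [not_or, not_le, not_le] at h
  obtain ⟨hl1, hl2⟩ := h
  set p : ℝ := ‖V.starProjection x‖ with hp
  set q : ℝ := ‖x - V.starProjection x‖ with hq
  have hp0 : 0 ≤ p := norm_nonneg _
  have hq0 : 0 ≤ q := norm_nonneg _
  have hxpq : p = 0 → q = 0 → False := by
    intro hp' hq'
    apply hx
    have hv0 : V.starProjection x = 0 := norm_eq_zero.1 hp'
    have hw0 : x - V.starProjection x = 0 := norm_eq_zero.1 hq'
    rwa [hv0, sub_zero] at hw0
  rcases le_or_gt p q with hpq | hpq
  · -- `(l − θ) q² ≤ ε p q ≤ ε q²`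
    rcases hq0.eq_or_lt with hq' | hq'
    · exact hxpq (le_antisymm (hq'.symm ▸ hpq) hp0) hq'.symm
    · have h3 : ε * p * q ≤ ε * q ^ 2 := by
        rw [sq, ← mul_assoc]
        exact mul_le_mul_of_nonneg_right (mul_le_mul_of_nonneg_left hpq hε) hq0
      have h4 : l - θ ≤ ε := le_of_mul_le_mul_right (h2.trans h3) (pow_pos hq' 2)
      linarith
  · -- `(a − l) p² ≤ ε p q ≤ ε p²`
    have hp' : 0 < p := hq0.trans_lt hpq
    have h3 : ε * p * q ≤ ε * p ^ 2 := by
      rw [sq, ← mul_assoc]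
      exact mul_le_mul_of_nonneg_left hpq.le (mul_nonneg hε hp0)
    have h4 : a - l ≤ ε := le_of_mul_le_mul_right (h1.trans h3) (pow_pos hp' 2)
    linarith

variable {ι : Type*} (b : HilbertBasis ι ℝ E)

/-- **The Rayleigh quotient in an eigenbasis**: `T` symmetric with `T bᵢ = λᵢ bᵢ` on a Hilbert basis ⇒
`⟪x, T x⟫ = Σᵢ λᵢ ⟪bᵢ, x⟫²`. [folklore] -/
theorem hasSum_eigenvalue_mul_inner_sq (T : E →L[ℝ] E) (hT : (T : E →ₗ[ℝ] E).IsSymmetric)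
    (lam : ι → ℝ) (hb : ∀ i, T (b i) = lam i • b i) (x : E) :
    HasSum (fun i => lam i * ⟪b i, x⟫_ℝ ^ 2) ⟪x, T x⟫_ℝ := by
  refine (b.hasSum_inner_mul_inner x (T x)).congr_fun fun i => ?_
  have h1 : ⟪b i, T x⟫_ℝ = lam i * ⟪b i, x⟫_ℝ := by
    rw [← ContinuousLinearMap.coe_coe, ← hT (b i) x, ContinuousLinearMap.coe_coe, hb i, real_inner_smul_left]
  change lam i * ⟪b i, x⟫_ℝ ^ 2 = ⟪x, b i⟫_ℝ * ⟪b i, T x⟫_ℝ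
  rw [h1, real_inner_comm (b i) x, sq]
  ring

/-- Parseval: `‖x‖² = Σᵢ ⟪bᵢ, x⟫²`. -/
theorem hasSum_inner_sq_norm_sq (x : E) : HasSum (fun i => ⟪b i, x⟫_ℝ ^ 2) (‖x‖ ^ 2) := by
  have h := b.hasSum_inner_mul_inner x x
  rw [real_inner_self_eq_norm_sq] at h
  refine h.congr_fun fun i => ?_
  change ⟪b i, x⟫_ℝ ^ 2 = ⟪x, b i⟫_ℝ * ⟪b i, x⟫_ℝ
  rw [real_inner_comm (b i) x, sq]

/-- **Rayleigh ceiling off a set of indices**: if `λᵢ ≤ c` for `i ∉ S` and `⟪bᵢ, x⟫ = 0` for `i ∈ S`, then `⟪x, T x⟫ ≤ c‖x‖²`. -/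
theorem inner_le_of_inner_eq_zero (T : E →L[ℝ] E) (hT : (T : E →ₗ[ℝ] E).IsSymmetric)
    (lam : ι → ℝ) (hb : ∀ i, T (b i) = lam i • b i) {S : Set ι} {c : ℝ}
    (hS : ∀ i, i ∉ S → lam i ≤ c) {x : E} (hx : ∀ i, i ∈ S → ⟪b i, x⟫_ℝ = 0) :
    ⟪x, T x⟫_ℝ ≤ c * ‖x‖ ^ 2 := by
  refine hasSum_le (fun i => ?_) (hasSum_eigenvalue_mul_inner_sq b T hT lam hb x)
    ((hasSum_inner_sq_norm_sq b x).mul_left c)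
  by_cases hi : i ∈ S
  · rw [hx i hi]; simp
  · exact mul_le_mul_of_nonneg_right (hS i hi) (sq_nonneg _)

/-- **Rayleigh floor on a set of indices**: if `c ≤ λᵢ` for `i ∈ S` and `⟪bᵢ, x⟫ = 0` for `i ∉ S`, then `c‖x‖² ≤ ⟪x, T x⟫`. -/
theorem le_inner_of_inner_eq_zero (T : E →L[ℝ] E) (hT : (T : E →ₗ[ℝ] E).IsSymmetric)
    (lam : ι → ℝ) (hb : ∀ i, T (b i) = lam i • b i) {S : Set ι} {c : ℝ}
    (hS : ∀ i, i ∈ S → c ≤ lam i) {x : E} (hx : ∀ i, i ∉ S → ⟪b i, x⟫_ℝ = 0) :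
    c * ‖x‖ ^ 2 ≤ ⟪x, T x⟫_ℝ := by
  refine hasSum_le (fun i => ?_) ((hasSum_inner_sq_norm_sq b x).mul_left c)
    (hasSum_eigenvalue_mul_inner_sq b T hT lam hb x)
  by_cases hi : i ∈ S
  · exact mul_le_mul_of_nonneg_right (hS i hi) (sq_nonneg _)
  · rw [hx i hi]; simp

/-- A vector whose coefficients vanish off a finite set `s` is the finite sum `x = Σ_{i ∈ s} ⟪bᵢ, x⟫ bᵢ`. -/
theorem eq_sum_inner_smul_of_inner_eq_zero (s : Finset ι) {x : E} (hx : ∀ j, j ∉ s → ⟪b j, x⟫_ℝ = 0) :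
    x = ∑ i ∈ s, ⟪b i, x⟫_ℝ • b i := by
  have hsum : HasSum (fun i => b.repr x i • b i) (∑ i ∈ s, ⟪b i, x⟫_ℝ • b i) := by
    rw [show (∑ i ∈ s, ⟪b i, x⟫_ℝ • b i) = ∑ i ∈ s, b.repr x i • b i from
      Finset.sum_congr rfl fun i _ => by rw [b.repr_apply_apply]]
    refine hasSum_sum_of_ne_finset_zero fun i hi => ?_
    rw [b.repr_apply_apply, hx i hi, zero_smul]
  exact (b.hasSum_repr x).unique hsum

/-- **A finite set of basis vectors spans exactly the vectors with no other coefficients**: for a finite `s`,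
`x ∈ span {bᵢ : i ∈ s} ↔ ⟪bⱼ, x⟫ = 0` for all `j ∉ s` (`⇐`: the expansion `x = Σᵢ ⟪bᵢ, x⟫ bᵢ` is a finite sum). -/
theorem mem_span_finset_iff_inner_eq_zero (s : Finset ι) (x : E) :
    x ∈ Submodule.span ℝ (Set.range fun k : s => b k) ↔ ∀ j, j ∉ s → ⟪b j, x⟫_ℝ = 0 := by
  classical
  constructor
  · intro hx j hj
    refine Submodule.span_induction (p := fun y _ => ⟪b j, y⟫_ℝ = 0) ?_ ?_ ?_ ?_ hx
    · rintro _ ⟨k, rfl⟩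
      have hjk : j ≠ (k : ι) := fun h => hj (h ▸ k.2)
      exact b.orthonormal.2 hjk
    · exact inner_zero_right _
    · intro y z _ _ hy hz
      rw [inner_add_right, hy, hz, add_zero]
    · intro c y _ hy
      rw [real_inner_smul_right, hy, mul_zero]
  · intro hx
    rw [eq_sum_inner_smul_of_inner_eq_zero b s hx]
    refine Submodule.sum_mem _ fun i hi => Submodule.smul_mem _ _ (Submodule.subset_span ⟨⟨i, hi⟩, rfl⟩)


/-! #### The window above the gap: dichotomy for the eigenbasis, exact count, structure -/

/- Standing data: `T` symmetric, diagonal in the Hilbert basis `b` with eigenvalues `lam`; a FINITE-DIMENSIONAL quasi-band `V`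
with Rayleigh floor `a`, a Rayleigh ceiling `θ` on `Vᗮ`, coupling `ε ≥ 0`, and the gap `θ + 2ε < a`. -/
variable (T : E →L[ℝ] E) (hT : (T : E →ₗ[ℝ] E).IsSymmetric) (lam : ι → ℝ) (hb : ∀ i, T (b i) = lam i • b i)
  (V : Submodule ℝ E) [FiniteDimensional ℝ V] {a θ ε : ℝ} (hε : 0 ≤ ε) (hgap : θ + 2 * ε < a)
  (hV : ∀ v ∈ V, a * ‖v‖ ^ 2 ≤ ⟪v, T v⟫_ℝ)
  (hVp : ∀ w ∈ Vᗮ, ⟪w, T w⟫_ℝ ≤ θ * ‖w‖ ^ 2)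
  (hcross : ∀ v ∈ V, ∀ w ∈ Vᗮ, |⟪w, T v⟫_ℝ| ≤ ε * ‖v‖ * ‖w‖)
include hT hb hε hV hVp hcross

/-- **Dichotomy for the eigenbasis**: every `λᵢ` is `≤ θ + ε` or `≥ a − ε`. -/
theorem eigenvalue_basis_le_or_le (i : ι) : lam i ≤ θ + ε ∨ a - ε ≤ lam i := by
  haveI : CompleteSpace V := FiniteDimensional.complete ℝ V
  have hbi : b i ≠ 0 := fun h => by simpa [h] using b.orthonormal.1 i
  exact eigenvalue_le_or_le_of_quasiBand T hT V hε hV hVp hcross hbi (hb i)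

include hgap

/-- **The quasi-band sees the whole window**: a vector of `V` orthogonal to every window basis vector (`λᵢ ≥ a − ε`) vanishes
(its Rayleigh quotient would be `≤ θ + ε < a`). -/
theorem eq_zero_of_mem_quasiBand_of_inner_window_eq_zero {v : E} (hv : v ∈ V)
    (h0 : ∀ i, a - ε ≤ lam i → ⟪b i, v⟫_ℝ = 0) : v = 0 := by
  have hceil : ⟪v, T v⟫_ℝ ≤ (θ + ε) * ‖v‖ ^ 2 :=
    inner_le_of_inner_eq_zero b T hT lam hb (S := {i | a - ε ≤ lam i}) (c := θ + ε)
      (fun i hi => (eigenvalue_basis_le_or_le b T hT lam hb V hε hV hVp hcross i).resolve_right hi) h0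
  have hfloor := hV v hv
  have h1 : (a - (θ + ε)) * ‖v‖ ^ 2 ≤ 0 := by nlinarith
  have h2 : ‖v‖ ^ 2 ≤ 0 := by
    by_contra h
    exact absurd h1 (not_le.2 (mul_pos (by linarith) (not_le.1 h)))
  have h3 : ‖v‖ = 0 := pow_eq_zero_iff (two_ne_zero) |>.1 (le_antisymm h2 (sq_nonneg _))
  exact norm_eq_zero.1 h3

omit [FiniteDimensional ℝ V] hV hcross in
/-- **The window sees the whole quasi-band**: a vector with coefficients only in the window (`⟪bᵢ, x⟫ = 0` whenever
`λᵢ < a − ε`) that is orthogonal to `V` vanishes (its Rayleigh quotient would be `≥ a − ε > θ`). -/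
theorem eq_zero_of_mem_orthogonal_of_inner_eq_zero {x : E} (hx : x ∈ Vᗮ)
    (h0 : ∀ i, ¬ a - ε ≤ lam i → ⟪b i, x⟫_ℝ = 0) : x = 0 := by
  have hfloor : (a - ε) * ‖x‖ ^ 2 ≤ ⟪x, T x⟫_ℝ :=
    le_inner_of_inner_eq_zero b T hT lam hb (S := {i | a - ε ≤ lam i}) (c := a - ε) (fun i hi => hi) h0
  have hceil := hVp x hx
  have h1 : (a - ε - θ) * ‖x‖ ^ 2 ≤ 0 := by nlinarith
  have h2 : ‖x‖ ^ 2 ≤ 0 := by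
    by_contra h
    exact absurd h1 (not_le.2 (mul_pos (by linarith) (not_le.1 h)))
  have h3 : ‖x‖ = 0 := pow_eq_zero_iff (two_ne_zero) |>.1 (le_antisymm h2 (sq_nonneg _))
  exact norm_eq_zero.1 h3

/-- **Exact count of the window (quasi-band isolation).**  `T` symmetric with a Hilbert eigenbasis `(bᵢ, λᵢ)`, `V` a
finite-dimensional quasi-band (floor `a` on `V`, ceiling `θ` on `Vᗮ`, coupling `ε ≥ 0`, gap `θ + 2ε < a`): the set of indices
with `λᵢ ≥ a − ε` is FINITE and has exactly `dim V` elements — together with `eigenvalue_basis_le_or_le`, the spectrum in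
`(θ + ε, ∞)` consists of precisely `dim V` eigenvalues (with multiplicity), all `≥ a − ε`.  (`P_V` is injective on their span and
the coefficient map `v ↦ (⟪bᵢ, v⟫)ᵢ` is injective on `V`.) [folklore: Temple / Davis–Kahan / min–max] -/
theorem exists_finset_window_card_eq_finrank :
    ∃ s : Finset ι, (∀ i, i ∈ s ↔ a - ε ≤ lam i) ∧ s.card = Module.finrank ℝ V := by
  classical
  haveI : CompleteSpace V := FiniteDimensional.complete ℝ V
  -- any finite set of window indices has at most `dim V` elements
  have hcard : ∀ s : Finset ι, (∀ i ∈ s, a - ε ≤ lam i) → s.card ≤ Module.finrank ℝ V := by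
    intro s hs
    let g : s → V := fun k => V.orthogonalProjectionOnto (b k)
    have hg : LinearIndependent ℝ g := by
      rw [Fintype.linearIndependent_iff]
      intro c hc k₀
      set x : E := ∑ k : s, c k • b (k : ι) with hxdef
      have hPx : V.orthogonalProjectionOnto x = 0 := by
        rw [hxdef, map_sum]
        simpa only [map_smul] using hc
      have hxperp : x ∈ Vᗮ := V.orthogonalProjectionOnto_eq_zero_iff.1 hPx
      have hcoef : ∀ j, ⟪b j, x⟫_ℝ = ∑ k : s, c k * (if j = (k : ι) then (1 : ℝ) else 0) := fun j => by
        rw [hxdef, inner_sum]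
        refine Finset.sum_congr rfl fun k _ => ?_
        rw [real_inner_smul_right, orthonormal_iff_ite.1 b.orthonormal]
      have hzero : ∀ j, ¬ a - ε ≤ lam j → ⟪b j, x⟫_ℝ = 0 := by
        intro j hj
        rw [hcoef j]
        refine Finset.sum_eq_zero fun k _ => ?_
        have : j ≠ (k : ι) := fun h => hj (h ▸ hs k k.2)
        rw [if_neg this, mul_zero]
      have hx0 : x = 0 :=
        eq_zero_of_mem_orthogonal_of_inner_eq_zero b T hT lam hb V hε hgap hVp hxperp hzero
      have hck : ⟪b (k₀ : ι), x⟫_ℝ = c k₀ := by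
        rw [hcoef, Finset.sum_eq_single k₀]
        · rw [if_pos rfl, mul_one]
        · intro k _ hk
          rw [if_neg (fun h => hk (Subtype.ext h).symm), mul_zero]
        · exact fun h => absurd (Finset.mem_univ k₀) h
      rw [← hck, hx0, inner_zero_right]
    have h := hg.fintype_card_le_finrank
    rwa [Fintype.card_coe] at h
  -- hence the window is finite
  have hfin : Set.Finite {i | a - ε ≤ lam i} := by
    by_contra hinf
    obtain ⟨t, ht, htc⟩ := Set.Infinite.exists_subset_card_eq hinf (Module.finrank ℝ V + 1)
    have h := hcard t fun i hi => ht (Finset.mem_coe.2 hi)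
    omega
  refine ⟨hfin.toFinset, fun i => hfin.mem_toFinset, le_antisymm (hcard _ fun i hi => hfin.mem_toFinset.1 hi) ?_⟩
  -- and the coefficient map `V → ℝ^{window}` is injective
  set s := hfin.toFinset with hsdef
  let L : V →ₗ[ℝ] (s → ℝ) :=
    { toFun := fun v k => ⟪b (k : ι), (v : E)⟫_ℝ
      map_add' := fun v w => by ext k; simp [inner_add_right]
      map_smul' := fun c v => by ext k; simp [real_inner_smul_right] }
  have hL : Function.Injective L := by
    rw [← LinearMap.ker_eq_bot, LinearMap.ker_eq_bot']
    intro v hv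
    have h0 : ∀ i, a - ε ≤ lam i → ⟪b i, (v : E)⟫_ℝ = 0 := fun i hi => by
      have h := congr_fun hv ⟨i, hfin.mem_toFinset.2 hi⟩
      simpa [L] using h
    exact Subtype.ext (eq_zero_of_mem_quasiBand_of_inner_window_eq_zero b T hT lam hb V hε hgap hV hVp hcross v.2 h0)
  have h := LinearMap.finrank_le_finrank_of_injective hL
  rwa [Module.finrank_fintype_fun_eq_card, Fintype.card_coe] at h

omit hε hgap hV hVp hcross in
/-- **A separated spectral window is invariant under every operator commuting with `T`.**  For a finite index set `s` whose
eigenvalues are separated from all the others (`λⱼ ≠ λₖ` for `k ∈ s`, `j ∉ s`), any linear `L` with `L ∘ T = T ∘ L` maps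
`span {b_k : k ∈ s}` into itself (`L b_k` is a `λ_k`-eigenvector, hence orthogonal to every `bⱼ`, `j ∉ s`). [folklore] -/
theorem map_mem_span_window_of_commute (s : Finset ι) (hsep : ∀ k, k ∈ s → ∀ j, j ∉ s → lam j ≠ lam k)
    (L : E →ₗ[ℝ] E) (hL : ∀ x, L (T x) = T (L x)) {x : E}
    (hx : x ∈ Submodule.span ℝ (Set.range fun k : s => b k)) :
    L x ∈ Submodule.span ℝ (Set.range fun k : s => b k) := by
  suffices h : ∀ k : s, L (b k) ∈ Submodule.span ℝ (Set.range fun k : s => b k) by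
    have hle : Submodule.span ℝ (Set.range fun k : s => b k) ≤
        (Submodule.span ℝ (Set.range fun k : s => b k)).comap L :=
      Submodule.span_le.2 (Set.range_subset_iff.2 h)
    exact hle hx
  intro k
  rw [mem_span_finset_iff_inner_eq_zero]
  intro j hj
  have hTk : T (L (b k)) = lam k • L (b k) := by rw [← hL, hb, map_smul]
  rcases eq_or_inner_eq_zero_of_eigen hT (x := b j) (e := L (b k)) (l := lam j) (μ := lam k)
    (by simpa using hb j) (by simpa using hTk) with h | h
  · exact absurd h (hsep k k.2 j hj)
  · exact h

omit hT hb hε hgap hV hVp hcross in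
/-- **The orthogonal projection onto an invariant finite-dimensional subspace commutes with the isometry.**  If a linear isometry
`U` maps a finite-dimensional subspace `W` into itself, then `P_W (U y) = U (P_W y)` for every `y` (`U(W) = W` by the dimension
count, hence `U(Wᗮ) ⊥ W`). [folklore] -/
theorem starProjection_map_eq_map_starProjection (W : Submodule ℝ E) [FiniteDimensional ℝ W] [W.HasOrthogonalProjection]
    (U : E →ₗᵢ[ℝ] E) (hU : ∀ x ∈ W, U x ∈ W) (y : E) :
    W.starProjection (U y) = U (W.starProjection y) := by
  have hle : W.map (U.toLinearMap : E →ₗ[ℝ] E) ≤ W := by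
    rintro _ ⟨x, hx, rfl⟩
    exact hU x hx
  have heq : W.map (U.toLinearMap : E →ₗ[ℝ] E) = W :=
    Submodule.eq_of_le_of_finrank_le hle (Submodule.equivMapOfInjective _ U.injective W).finrank_eq.le
  refine W.eq_starProjection_of_mem_orthogonal' (z := U (y - W.starProjection y))
    (hU _ (W.starProjection_apply_mem y)) ?_ ?_
  · rw [Submodule.mem_orthogonal]
    intro u hu
    rw [← heq] at hu
    obtain ⟨u', hu', rfl⟩ := hu
    rw [LinearIsometry.coe_toLinearMap, U.inner_map_map]
    exact W.inner_right_of_mem_orthogonal hu' (W.sub_starProjection_mem_orthogonal y)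
  · rw [← map_add, add_sub_cancel]

omit [FiniteDimensional ℝ V] hT hb hε hgap hV hVp hcross in
/-- **Projecting a linearly independent family onto a subspace that sees it keeps it linearly independent.**  If `P_W` is injective
on `V ⊇ {φ_a}`, then `(P_W φ_a)_a` is linearly independent when `(φ_a)_a` is. -/
theorem linearIndependent_starProjection_comp (W : Submodule ℝ E) [W.HasOrthogonalProjection] {κ : Type*} {φ : κ → E}
    (hφ : LinearIndependent ℝ φ) (hφV : ∀ a, φ a ∈ V) (hinj : ∀ v ∈ V, W.starProjection v = 0 → v = 0) :
    LinearIndependent ℝ (fun a => W.starProjection (φ a)) := by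
  refine hφ.map (f := (W.starProjection : E →ₗ[ℝ] E)) ?_
  rw [Submodule.disjoint_def]
  intro x hx hker
  exact hinj x (Submodule.span_le.2 (Set.range_subset_iff.2 hφV) hx) (LinearMap.mem_ker.1 hker)

omit hT hb hε hgap hV hVp hcross in
/-- A linearly independent family inside a finite-dimensional subspace `W` with `dim W` members spans `W`. -/
theorem span_eq_of_linearIndependent_of_card_eq (W : Submodule ℝ E) [FiniteDimensional ℝ W] {κ : Type*} [Fintype κ]
    {φ : κ → E} (hφ : LinearIndependent ℝ φ) (hφW : ∀ a, φ a ∈ W) (hcard : Fintype.card κ = Module.finrank ℝ W) :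
    Submodule.span ℝ (Set.range φ) = W :=
  Submodule.eq_of_le_of_finrank_le (Submodule.span_le.2 (Set.range_subset_iff.2 hφW))
    (by rw [finrank_span_eq_card hφ, hcard])

end Abstract

end Summit.QuantumFields.YangMills.Theorems.GlueballBandRecursion.Band

end
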